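import Summits.NavierStokesRegularity.FunctionalMining.StretchingConfinementErrors
import HarnessLib

/-!
# K1-Q1, the wrap blueprint: node N2 `ConfinementLemma` holds

Cell `pub-nsfunc` (host summit NavierStokesRegularity, topic `FunctionalMining`), prove seat gen 5, kernel proof of node
**N2 `ConfinementLemma`** of the bank seat's `WRAP-KERNEL-BLUEPRINT.md` §5, as typed by the dictionary seat in
`StretchingWrapIdentity.lean`. **Search for candidate a priori estimates; no regularity claim.** Static facts about smooth fields on `T³`;
nothing is asserted about Navier–Stokes.

This part: scaling of vorticity statistics under `u ↦ c•u`, vanishing of the confined curl on open sets where the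
envelope vanishes, the per-`m` error bounds `|stat(u_m) − target| ≤ D/m` (production, enstrophy, second moments; the
two-scale constants enter through hypotheses discharged by `two_scale`), the rescaling `λ_m = (1 + 4ρ_m)⁻¹` making
`|ω|² ≤ 1` exact, and the headline **`confinementLemma_holds : ConfinementLemma`**. Together with
`wrapIdentityBound_holds` (N1) and `plateauEnvelope_holds` (N4), the dictionary's kernel assemblies
(`confinedPlus_of_confinement`, `oneSided_le_stretchingSupConst_of_wrapIdentity`, `nestedLowerBound_of_blueprint`)
now reduce `(4+3√2)/16 ≤ C⋆`, `C_{2.5D} < C⋆` and `(2+√5)/8 ≤ C⋆` to the single filler node N3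
(`PlanarFillerFamilyPotPlus` / `…Minus`).
-/

noncomputable section

open MeasureTheory Set Filter Topology Function
open scoped InnerProductSpace ContDiff

namespace Summit.NavierStokesRegularity.FunctionalMining

open Literature.Analysis Literature.Analysis.FunctionSpaces Literature.Analysis.FunctionSpaces.Torus
open Literature.Analysis.FluidPDE Literature.Analysis.FluidPDE.Torus

namespace Confinement

open CellularStretching WrapStretching

/-! ## 8. Scaling of vorticity statistics and support of the confined curl -/

/-- `ω(c•u) = c·ω(u)` componentwise. [folklore] -/
theorem vorticityComp_const_smul {u : UnitAddTorus (Fin 3) → EuclideanSpace ℝ (Fin 3)} (hu : IsSmooth u) (c : ℝ)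
    (x : UnitAddTorus (Fin 3)) (i : Fin 3) : vorticityComp (c • u) x i = c * vorticityComp u x i := by
  have h1 : IsContDiff 1 u := hu.isContDiff (by simp)
  rw [vorticityComp_eq, vorticityComp_eq, partialDeriv_const_smul h1, partialDeriv_const_smul h1]
  simp only [Pi.smul_apply, PiLp.smul_apply, smul_eq_mul]
  ring

/-- `|ω(c•u)|² = c²|ω(u)|²`. [folklore] -/
theorem torusVorticitySqAt_const_smul {u : UnitAddTorus (Fin 3) → EuclideanSpace ℝ (Fin 3)} (hu : IsSmooth u) (c : ℝ)
    (x : UnitAddTorus (Fin 3)) : torusVorticitySqAt (c • u) x = c ^ 2 * torusVorticitySqAt u x := by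
  rw [torusVorticitySqAt_eq_sum_sq, torusVorticitySqAt_eq_sum_sq, Finset.mul_sum]
  refine Finset.sum_congr rfl fun i _ => ?_
  rw [vorticityComp_const_smul hu]; ring

/-- `T_ii(c•u) = c²T_ii(u)`. [folklore] -/
theorem vorticityMoment_const_smul {u : UnitAddTorus (Fin 3) → EuclideanSpace ℝ (Fin 3)} (hu : IsSmooth u) (c : ℝ)
    (i : Fin 3) : vorticityMoment (c • u) i i = c ^ 2 * vorticityMoment u i i := by
  unfold vorticityMoment
  rw [← integral_const_mul]
  refine integral_congr_ae (ae_of_all _ fun x => ?_)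
  simp only [vorticityComp_const_smul hu]
  ring

/-- **The confined curl vanishes on open sets where the envelope vanishes.** [ours; elementary] -/
theorem curlField_confine_eq_zero {E : UnitAddTorus (Fin 3) → ℝ} {V : UnitAddTorus (Fin 3) → EuclideanSpace ℝ (Fin 3)}
    {O : Set (UnitAddTorus (Fin 3))} (hO : IsOpen O) (hEO : ∀ x ∈ O, E x = 0) {x : UnitAddTorus (Fin 3)} (hx : x ∈ O) :
    curlField (confine E V) x = 0 := by
  have hB : ∀ y ∈ O, confine E V y = 0 := fun y hy => by simp [confine, hEO y hy]
  have hD : ∀ j, Torus.partialDeriv j (confine E V) x = 0 := fun j => partialDeriv_eq_zero_of_vanish hO hB hx j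
  ext i
  rw [curlField_apply, hD, hD]
  simp

/-! ## 9. The confinement lemma -/

/-- Real bookkeeping for the rescaling `λ = (1+4ρ)⁻¹`: `0 < λ ≤ 1`, `λ²(1+4ρ)² = 1`, `1 − λ² ≤ 8ρ`, `1 − λ³ ≤ 12ρ`.
[folklore] -/
theorem lambda_facts {ρ : ℝ} (hρ : 0 ≤ ρ) :
    0 < (1 + 4 * ρ)⁻¹ ∧ (1 + 4 * ρ)⁻¹ ≤ 1 ∧ (1 + 4 * ρ)⁻¹ ^ 2 * (1 + 4 * ρ) ^ 2 = 1 ∧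
      1 - (1 + 4 * ρ)⁻¹ ^ 2 ≤ 8 * ρ ∧ 1 - (1 + 4 * ρ)⁻¹ ^ 3 ≤ 12 * ρ := by
  have h1 : 0 < 1 + 4 * ρ := by linarith
  set l := (1 + 4 * ρ)⁻¹ with hl
  have hl0 : 0 < l := inv_pos.2 h1
  have hl1 : l ≤ 1 := inv_le_one_of_one_le₀ (by linarith)
  have hll : l * (1 + 4 * ρ) = 1 := inv_mul_cancel₀ h1.ne'
  have h1l : 1 - l = 4 * ρ * l := by nlinarith
  have h1l' : 1 - l ≤ 4 * ρ := by nlinarith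
  refine ⟨hl0, hl1, by nlinarith, ?_, ?_⟩
  · nlinarith [mul_nonneg hl0.le hl0.le]
  · nlinarith [mul_nonneg hl0.le hl0.le, mul_nonneg (mul_nonneg hl0.le hl0.le) hl0.le]

/-- `|c·a − t| ≤ |a − t| + (1 − c)|t|` for `0 ≤ c ≤ 1`. [folklore] -/
theorem abs_scaled_sub_le {c a t : ℝ} (hc0 : 0 ≤ c) (hc1 : c ≤ 1) : |c * a - t| ≤ |a - t| + (1 - c) * |t| := by
  have e : c * a - t = c * (a - t) - (1 - c) * t := by ring
  rw [e]
  calc |c * (a - t) - (1 - c) * t| ≤ |c * (a - t)| + |(1 - c) * t| := abs_sub _ _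
    _ = c * |a - t| + (1 - c) * |t| := by
        rw [abs_mul, abs_mul, abs_of_nonneg hc0, abs_of_nonneg (by linarith : 0 ≤ 1 - c)]
    _ ≤ |a - t| + (1 - c) * |t| := by nlinarith [abs_nonneg (a - t)]

/-- Real bookkeeping: `ρ(β+ρ)² ≤ (K/m)(β+K)²` and `ρ(β+ρ) ≤ (K/m)(β+K)` for `ρ = K/m ≤ K`, `β ≥ 0`. [folklore] -/
theorem rho_poly_le {K β : ℝ} {m : ℕ} (hK : 0 ≤ K) (hβ : 0 ≤ β) (hm : 1 ≤ m) :
    K / m * (β + K / m) ^ 2 ≤ K * (β + K) ^ 2 / m ∧ K / m * (β + K / m) ≤ K * (β + K) / m := by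
  have hmr : (1 : ℝ) ≤ m := by exact_mod_cast hm
  have hmpos : (0 : ℝ) < m := by linarith
  have hρ : K / m ≤ K := div_le_self hK hmr
  have hρ0 : 0 ≤ K / m := div_nonneg hK hmpos.le
  constructor
  · rw [mul_div_right_comm]  -- K * (β+K)^2 / m = K / m * (β + K)^2
    exact mul_le_mul_of_nonneg_left (pow_le_pow_left₀ (by linarith) (by linarith) 2) hρ0
  · rw [mul_div_right_comm]
    exact mul_le_mul_of_nonneg_left (by linarith) hρ0

section Errors

variable {E : UnitAddTorus (Fin 3) → ℝ} {A : UnitAddTorus (Fin 3) → EuclideanSpace ℝ (Fin 3)}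
variable {L₁ L₂ a₀ a₁ β C₃ C₂ Ct : ℝ}
variable (hE : IsSmooth E) (hA : IsSmooth A) (hE01 : ∀ x, 0 ≤ E x ∧ E x ≤ 1)
  (hE1 : ∀ a x, |Torus.partialDeriv a E x| ≤ L₁)
  (hE2 : ∀ j a x, |Torus.partialDeriv j (Torus.partialDeriv a E) x| ≤ L₂)
  (hA0 : ∀ x b, |A x b| ≤ a₀) (hA1 : ∀ j x b, |Torus.partialDeriv j A x b| ≤ a₁)
  (hβ : ∀ x i j, |gradAt (curlField A) x i j| ≤ β)
  (hL₁ : 0 ≤ L₁) (hL₂ : 0 ≤ L₂) (ha₀ : 0 ≤ a₀) (ha₁ : 0 ≤ a₁) (hβ0 : 0 ≤ β)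

include hE hA hE01 hE1 hE2 hA0 hA1 hβ hL₁ hL₂ ha₀ ha₁ hβ0 in
/-- **Production error at level `m`** (given the two-scale bound with constant `C₃`). [ours] -/
theorem production_error {m : ℕ} (hm : 1 ≤ m) (hC₃ : 0 ≤ C₃)
    (hTS : |(∫ x, E x ^ 3 * prodBC (gradAt (curlField A) (m • x))) -
      (∫ x, E x ^ 3) * ∫ x, prodBC (gradAt (curlField A) x)| ≤ C₃ / (m : ℝ) ^ 2) :
    |enstrophyProduction (curlField (confine E (rescale A m))) -
        enstrophyProduction (curlField A) * ∫ x, E x ^ 3| ≤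
      (162 * (2 * L₂ * a₀ + 4 * L₁ * a₁) * (β + (2 * L₂ * a₀ + 4 * L₁ * a₁)) ^ 2 + C₃) / m := by
  have hF : IsSmooth (curlField A) := isSmooth_curlField hA
  have hdF : IsDivFree (curlField A) := isDivFree_curlField hA
  have hmr : (1 : ℝ) ≤ m := by exact_mod_cast hm
  have hmpos : (0 : ℝ) < m := by linarith
  set K := 2 * L₂ * a₀ + 4 * L₁ * a₁ with hKdef
  have hK : 0 ≤ K := by positivity
  have e1 := (integrated_errors hE hA hE01 hE1 hE2 hA0 hA1 hβ hm).1
  have hρ : rho L₁ L₂ a₀ a₁ m = K / m := rfl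
  rw [hρ] at e1
  rw [← enstrophyProduction_eq_integral_prodBC hF hdF, mul_comm] at hTS
  have h2 : C₃ / (m : ℝ) ^ 2 ≤ C₃ / m := div_le_div_of_nonneg_left hC₃ hmpos (by nlinarith)
  have h1 := (rho_poly_le hK hβ0 hm).1
  calc _ ≤ |enstrophyProduction (curlField (confine E (rescale A m))) -
            ∫ x, E x ^ 3 * prodBC (gradAt (curlField A) (m • x))| +
          |(∫ x, E x ^ 3 * prodBC (gradAt (curlField A) (m • x))) -
            enstrophyProduction (curlField A) * ∫ x, E x ^ 3| := abs_sub_le _ _ _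
    _ ≤ 162 * (K / m) * (β + K / m) ^ 2 + C₃ / (m : ℝ) ^ 2 := add_le_add e1 hTS
    _ ≤ 162 * (K * (β + K) ^ 2 / m) + C₃ / m := by nlinarith
    _ = (162 * K * (β + K) ^ 2 + C₃) / m := by ring

include hE hA hE01 hE1 hE2 hA0 hA1 hβ hL₁ hL₂ ha₀ ha₁ hβ0 in
/-- **Enstrophy error at level `m`.** [ours] -/
theorem enstrophy_error {m : ℕ} (hm : 1 ≤ m) (hC₂ : 0 ≤ C₂)
    (hTS : |(∫ x, E x ^ 2 * ∑ i, vort (gradAt (curlField A) (m • x)) i ^ 2) -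
      (∫ x, E x ^ 2) * ∫ x, ∑ i, vort (gradAt (curlField A) x) i ^ 2| ≤ C₂ / (m : ℝ) ^ 2) :
    |torusEnstrophy (curlField (confine E (rescale A m))) - torusEnstrophy (curlField A) * ∫ x, E x ^ 2| ≤
      (12 * (2 * L₂ * a₀ + 4 * L₁ * a₁) * (β + (2 * L₂ * a₀ + 4 * L₁ * a₁)) + C₂ / 2) / m := by
  have hF : IsSmooth (curlField A) := isSmooth_curlField hA
  have hdF : IsDivFree (curlField A) := isDivFree_curlField hA
  have hmr : (1 : ℝ) ≤ m := by exact_mod_cast hm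
  have hmpos : (0 : ℝ) < m := by linarith
  set K := 2 * L₂ * a₀ + 4 * L₁ * a₁ with hKdef
  have hK : 0 ≤ K := by positivity
  have e1 := (integrated_errors hE hA hE01 hE1 hE2 hA0 hA1 hβ hm).2.1
  have hρ : rho L₁ L₂ a₀ a₁ m = K / m := rfl
  rw [hρ] at e1
  rw [← two_mul_torusEnstrophy_eq_integral_vort hF hdF] at hTS
  have h2 : C₂ / (m : ℝ) ^ 2 ≤ C₂ / m := div_le_div_of_nonneg_left hC₂ hmpos (by nlinarith)
  have h1 := (rho_poly_le hK hβ0 hm).2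
  have h3 : |2 * torusEnstrophy (curlField (confine E (rescale A m))) -
      (∫ x, E x ^ 2) * (2 * torusEnstrophy (curlField A))| ≤ 24 * (K / m) * (β + K / m) + C₂ / (m : ℝ) ^ 2 :=
    (abs_sub_le _ _ _).trans (add_le_add e1 hTS)
  have e : 2 * torusEnstrophy (curlField (confine E (rescale A m))) - (∫ x, E x ^ 2) * (2 * torusEnstrophy (curlField A)) =
      2 * (torusEnstrophy (curlField (confine E (rescale A m))) - torusEnstrophy (curlField A) * ∫ x, E x ^ 2) := by ring
  rw [e, abs_mul, abs_two] at h3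
  calc _ ≤ 12 * (K / m) * (β + K / m) + C₂ / (m : ℝ) ^ 2 / 2 := by linarith
    _ ≤ 12 * (K * (β + K) / m) + C₂ / m / 2 := by nlinarith
    _ = (12 * K * (β + K) + C₂ / 2) / m := by ring

include hE hA hE01 hE1 hE2 hA0 hA1 hβ hL₁ hL₂ ha₀ ha₁ hβ0 in
/-- **Second-moment error at level `m`.** [ours] -/
theorem moment_error {m : ℕ} (hm : 1 ≤ m) (i : Fin 3) (hCt : 0 ≤ Ct)
    (hTS : |(∫ x, E x ^ 2 * vort (gradAt (curlField A) (m • x)) i ^ 2) -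
      (∫ x, E x ^ 2) * ∫ x, vort (gradAt (curlField A) x) i ^ 2| ≤ Ct / (m : ℝ) ^ 2) :
    |vorticityMoment (curlField (confine E (rescale A m))) i i - vorticityMoment (curlField A) i i * ∫ x, E x ^ 2| ≤
      (8 * (2 * L₂ * a₀ + 4 * L₁ * a₁) * (β + (2 * L₂ * a₀ + 4 * L₁ * a₁)) + Ct) / m := by
  have hmr : (1 : ℝ) ≤ m := by exact_mod_cast hm
  have hmpos : (0 : ℝ) < m := by linarith
  set K := 2 * L₂ * a₀ + 4 * L₁ * a₁ with hKdef
  have hK : 0 ≤ K := by positivity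
  have e1 := (integrated_errors hE hA hE01 hE1 hE2 hA0 hA1 hβ hm).2.2 i
  have hρ : rho L₁ L₂ a₀ a₁ m = K / m := rfl
  rw [hρ] at e1
  rw [← vorticityMoment_eq, mul_comm] at hTS
  have h2 : Ct / (m : ℝ) ^ 2 ≤ Ct / m := div_le_div_of_nonneg_left hCt hmpos (by nlinarith)
  have h1 := (rho_poly_le hK hβ0 hm).2
  calc _ ≤ |vorticityMoment (curlField (confine E (rescale A m))) i i -
            ∫ x, E x ^ 2 * vort (gradAt (curlField A) (m • x)) i ^ 2| +
          |(∫ x, E x ^ 2 * vort (gradAt (curlField A) (m • x)) i ^ 2) -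
            vorticityMoment (curlField A) i i * ∫ x, E x ^ 2| := abs_sub_le _ _ _
    _ ≤ 8 * (K / m) * (β + K / m) + Ct / (m : ℝ) ^ 2 := add_le_add e1 hTS
    _ ≤ 8 * (K * (β + K) / m) + Ct / m := by nlinarith
    _ = (8 * K * (β + K) + Ct) / m := by ring

include hE hA hE01 hE1 hE2 hA0 hA1 hβ in
/-- **Sup bound at level `m`**: `|ω(u_m)|² ≤ (1 + 4K/m)²` when `|Ω_F|² ≤ 1`. [ours] -/
theorem sup_at (hΩ : ∀ y, torusVorticitySqAt (curlField A) y ≤ 1) {m : ℕ} (hm : 1 ≤ m) (x : UnitAddTorus (Fin 3)) :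
    torusVorticitySqAt (curlField (confine E (rescale A m))) x ≤ (1 + 4 * ((2 * L₂ * a₀ + 4 * L₁ * a₁) / m)) ^ 2 :=
  (pointwise_errors hE hA hE01 hE1 hE2 hA0 hA1 hβ hm x).2.2 hΩ

end Errors

/-- Scaling bookkeeping: `|c·a − t| ≤ X + κ|t|` from `|a − t| ≤ X`, `0 ≤ c ≤ 1`, `1 − c ≤ κ`. [folklore] -/
theorem abs_scaled_sub_le' {c a t X κ : ℝ} (hc0 : 0 ≤ c) (hc1 : c ≤ 1) (hκ : 1 - c ≤ κ) (h : |a - t| ≤ X) :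
    |c * a - t| ≤ X + κ * |t| :=
  (abs_scaled_sub_le hc0 hc1).trans (add_le_add h (mul_le_mul_of_nonneg_right hκ (abs_nonneg t)))

/-- Choosing `m`: for `D ≥ 0`, `ε > 0` and `m = ⌈D/ε⌉₊ + 1`: `D/m ≤ ε`. [folklore] -/
theorem div_ceil_le {D ε : ℝ} (hε : 0 < ε) : D / ((⌈D / ε⌉₊ + 1 : ℕ) : ℝ) ≤ ε := by
  have h1 : D / ε ≤ ⌈D / ε⌉₊ := Nat.le_ceil _
  have hmpos : (0 : ℝ) < ((⌈D / ε⌉₊ + 1 : ℕ) : ℝ) := by positivity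
  rw [div_le_iff₀ hmpos]
  rw [div_le_iff₀ hε] at h1
  push_cast
  nlinarith

/-- **N2 of the bank's wrap blueprint holds: `ConfinementLemma`.** For a smooth potential `A` with
`|curl curl A|² ≤ 1`, a smooth envelope `0 ≤ E ≤ 1` and `ε′ > 0`, the field
`u = λ_m · curl(E · m⁻²A(m•·))` (`m` large, `λ_m = (1+4ρ_m)⁻¹`, `ρ_m = (2‖∇²E‖‖A‖ + 4‖∇E‖‖∇A‖)/m`) is smooth,
divergence free, vanishes on every open set where `E` does, has `|ω|² ≤ 1` exactly, and its enstrophy, production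
and second moments are within `ε′` of `ℰ(F)∫E²`, `σ(F)∫E³`, `T_ii(F)∫E²` (`F = curl A`). Two-scale step by the
literature's Green-pairing bound (`Mikado.abs_integral_mul_comp_nsmul_le`). With N1 (`wrapIdentityBound_holds`) and
N4 (`plateauEnvelope_holds`) the only open node of the blueprint is N3 (`PlanarFillerFamilyPot±`).
Search for candidate a priori estimates; no regularity claim. [ours] -/
theorem confinementLemma_holds : ConfinementLemma := by
  intro A hA hΩ E hE hE01 ε' hε'
  have hF : IsSmooth (curlField A) := isSmooth_curlField hA
  obtain ⟨L₁, hL₁, hE1⟩ := exists_forall₂_abs_le (f := fun a x => Torus.partialDeriv a E x)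
    fun a => (hE.partialDeriv a).continuous
  obtain ⟨L₂, hL₂, hE2⟩ := exists_forall₃_abs_le (f := fun j a x => Torus.partialDeriv j (Torus.partialDeriv a E) x)
    fun j a => ((hE.partialDeriv a).partialDeriv j).continuous
  obtain ⟨a₀, ha₀, hA0'⟩ := exists_forall₂_abs_le (f := fun b x => A x b) fun b => (hA.apply b).continuous
  obtain ⟨a₁, ha₁, hA1'⟩ := exists_forall₃_abs_le (f := fun j b x => Torus.partialDeriv j A x b)
    fun j b => ((hA.partialDeriv j).apply b).continuous
  obtain ⟨β, hβ0, hβ'⟩ := exists_forall₃_abs_le (f := fun i j x => gradAt (curlField A) x i j)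
    fun i j => (isSmooth_gradAt hF i j).continuous
  have hA0 : ∀ x b, |A x b| ≤ a₀ := fun x b => hA0' b x
  have hA1 : ∀ j x b, |Torus.partialDeriv j A x b| ≤ a₁ := fun j x b => hA1' j b x
  have hβ : ∀ x i j, |gradAt (curlField A) x i j| ≤ β := fun x i j => hβ' i j x
  obtain ⟨C₃, hC₃, hTS3⟩ := two_scale (isSmooth_pow' hE 3) (isSmooth_prodBC_gradAt hF)
  obtain ⟨C₂, hC₂, hTS2⟩ := two_scale (isSmooth_pow' hE 2) (isSmooth_sum_vort_sq hF)
  obtain ⟨Ct₁, hCt₁, hTSt₁⟩ := two_scale (isSmooth_pow' hE 2) (isSmooth_vort_sq hF 1)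
  obtain ⟨Ct₂, hCt₂, hTSt₂⟩ := two_scale (isSmooth_pow' hE 2) (isSmooth_vort_sq hF 2)
  -- constants
  have hK : 0 ≤ 2 * L₂ * a₀ + 4 * L₁ * a₁ := by positivity
  obtain ⟨K, hKdef⟩ : ∃ K, K = 2 * L₂ * a₀ + 4 * L₁ * a₁ := ⟨_, rfl⟩
  have hK0 : 0 ≤ K := hKdef ▸ hK
  obtain ⟨Dσ, hDσ⟩ : ∃ D, D = 162 * K * (β + K) ^ 2 + C₃ + 12 * K * |enstrophyProduction (curlField A) * ∫ x, E x ^ 3| :=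
    ⟨_, rfl⟩
  obtain ⟨DE, hDE⟩ : ∃ D, D = 12 * K * (β + K) + C₂ / 2 + 8 * K * |torusEnstrophy (curlField A) * ∫ x, E x ^ 2| :=
    ⟨_, rfl⟩
  obtain ⟨D₁, hD₁⟩ : ∃ D, D = 8 * K * (β + K) + Ct₁ + 8 * K * |vorticityMoment (curlField A) 1 1 * ∫ x, E x ^ 2| :=
    ⟨_, rfl⟩
  obtain ⟨D₂, hD₂⟩ : ∃ D, D = 8 * K * (β + K) + Ct₂ + 8 * K * |vorticityMoment (curlField A) 2 2 * ∫ x, E x ^ 2| :=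
    ⟨_, rfl⟩
  have hDσ0 : 0 ≤ Dσ := by rw [hDσ]; positivity
  have hDE0 : 0 ≤ DE := by rw [hDE]; positivity
  have hD₁0 : 0 ≤ D₁ := by rw [hD₁]; positivity
  have hD₂0 : 0 ≤ D₂ := by rw [hD₂]; positivity
  obtain ⟨D, hD⟩ : ∃ D, D = Dσ + DE + D₁ + D₂ := ⟨_, rfl⟩
  -- the scale `m`
  obtain ⟨m, hmdef⟩ : ∃ m : ℕ, m = ⌈D / ε'⌉₊ + 1 := ⟨_, rfl⟩
  have hm1 : 1 ≤ m := by omega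
  have hmr : (1 : ℝ) ≤ m := by exact_mod_cast hm1
  have hmpos : (0 : ℝ) < m := by linarith
  have hDm : D / m ≤ ε' := by rw [hmdef]; exact div_ceil_le hε'
  have hρ0 : 0 ≤ K / m := div_nonneg hK0 hmpos.le
  obtain ⟨hl0, hl1, hlsq, hl2, hl3⟩ := lambda_facts hρ0
  -- the field and its errors
  have hBs : IsSmooth (confine E (rescale A m)) := isSmooth_confine hE (isSmooth_rescale m hA)
  have hus : IsSmooth (curlField (confine E (rescale A m))) := isSmooth_curlField hBs
  have hud : IsDivFree (curlField (confine E (rescale A m))) := isDivFree_curlField hBs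
  have eσ := production_error hE hA hE01 hE1 hE2 hA0 hA1 hβ hL₁ hL₂ ha₀ ha₁ hβ0 hm1 hC₃ (hTS3 m hm1)
  have eE := enstrophy_error hE hA hE01 hE1 hE2 hA0 hA1 hβ hL₁ hL₂ ha₀ ha₁ hβ0 hm1 hC₂ (hTS2 m hm1)
  have eT₁ := moment_error hE hA hE01 hE1 hE2 hA0 hA1 hβ hL₁ hL₂ ha₀ ha₁ hβ0 hm1 1 hCt₁ (hTSt₁ m hm1)
  have eT₂ := moment_error hE hA hE01 hE1 hE2 hA0 hA1 hβ hL₁ hL₂ ha₀ ha₁ hβ0 hm1 2 hCt₂ (hTSt₂ m hm1)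
  have hsup := sup_at hE hA hE01 hE1 hE2 hA0 hA1 hβ hΩ hm1
  rw [← hKdef] at eσ eE eT₁ eT₂ hsup
  refine ⟨(1 + 4 * (K / m))⁻¹ • curlField (confine E (rescale A m)), hus.smul _,
    isDivFree_const_smul (hus.isContDiff (by simp)) hud _, ?_, ?_, ?_, ?_, ?_, ?_⟩
  · intro O hO hEO x hx
    show (1 + 4 * (K / m))⁻¹ • curlField (confine E (rescale A m)) x = 0
    rw [curlField_confine_eq_zero hO hEO hx, smul_zero]
  · intro x
    rw [torusVorticitySqAt_const_smul hus]
    calc (1 + 4 * (K / m))⁻¹ ^ 2 * torusVorticitySqAt (curlField (confine E (rescale A m))) x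
        ≤ (1 + 4 * (K / m))⁻¹ ^ 2 * (1 + 4 * (K / ↑m)) ^ 2 :=
          mul_le_mul_of_nonneg_left (hsup x) (sq_nonneg _)
      _ = 1 := hlsq
  · rw [torusEnstrophy_const_smul (hus.isContDiff (by simp))]
    have h := abs_scaled_sub_le' (sq_nonneg _) (pow_le_one₀ hl0.le hl1) hl2 eE
    have hb : (12 * K * (β + K) + C₂ / 2) / m + 8 * (K / m) * |torusEnstrophy (curlField A) * ∫ x, E x ^ 2| =
        DE / m := by rw [hDE]; ring
    rw [hb] at h
    exact h.trans ((div_le_div_of_nonneg_right (by linarith) hmpos.le).trans hDm)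
  · rw [enstrophyProduction_const_smul hus]
    have h := abs_scaled_sub_le' (pow_nonneg hl0.le 3) (pow_le_one₀ hl0.le hl1) hl3 eσ
    have hb : (162 * K * (β + K) ^ 2 + C₃) / m + 12 * (K / m) * |enstrophyProduction (curlField A) * ∫ x, E x ^ 3| =
        Dσ / m := by rw [hDσ]; ring
    rw [hb] at h
    exact h.trans ((div_le_div_of_nonneg_right (by linarith) hmpos.le).trans hDm)
  · rw [vorticityMoment_const_smul hus]
    have h := abs_scaled_sub_le' (sq_nonneg _) (pow_le_one₀ hl0.le hl1) hl2 eT₁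
    have hb : (8 * K * (β + K) + Ct₁) / m + 8 * (K / m) * |vorticityMoment (curlField A) 1 1 * ∫ x, E x ^ 2| =
        D₁ / m := by rw [hD₁]; ring
    rw [hb] at h
    exact h.trans ((div_le_div_of_nonneg_right (by linarith) hmpos.le).trans hDm)
  · rw [vorticityMoment_const_smul hus]
    have h := abs_scaled_sub_le' (sq_nonneg _) (pow_le_one₀ hl0.le hl1) hl2 eT₂
    have hb : (8 * K * (β + K) + Ct₂) / m + 8 * (K / m) * |vorticityMoment (curlField A) 2 2 * ∫ x, E x ^ 2| =
        D₂ / m := by rw [hD₂]; ring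
    rw [hb] at h
    exact h.trans ((div_le_div_of_nonneg_right (by linarith) hmpos.le).trans hDm)

end Confinement

end Summit.NavierStokesRegularity.FunctionalMining

end
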